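import Summits.Ventures.CertifiedManyBodySolver.Downfold.EmeryAxialSlabTl2223IPSubsA
import Summits.Ventures.CertifiedManyBodySolver.Downfold.EmeryAxialSlabTl2223IPSubsB
import Summits.Ventures.CertifiedManyBodySolver.Downfold.EmeryAxialSlabTl2223IPSubsC
import Summits.Ventures.CertifiedManyBodySolver.Downfold.EmeryFermiFillingLa214
import HarnessLib

/-!
# Tl₂Ba₂Ca₂Cu₃O₁₀ INNER plane (box #306 Tl-2223, (K) source rows): HOW MUCH AXIAL (Cu-4s / apical) ADMIXTURE DOES THE BOX'S ONE-BAND FERMI SURFACE REQUIRE? — the certified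
# co-shift census of the typed 3BE one-body box `emeryBoxTl2223IPK11Src` against its object-E row `t′/t ∈ [-0.447, -0.346]`

Venture CertifiedManyBodySolver, cell `pub/hubbard-downfold` (stage S1, HUMAN RULINGS D-0096/D-0098: the 3 → 1 reduction error is carried explicitly),
seat hubbard-downfold-mod-4 (technique B = band level); namespace `Summit.Ventures.CertifiedManyBodySolver.Downfold.Emery`. Everything PROVED; numerics
decided by the kernel in `EmeryAxialSlabTl2223IPSubsA`, `EmeryAxialSlabTl2223IPSubsB`, `EmeryAxialSlabTl2223IPSubsC`.

CONTEXT. `EmeryFermiFillingTl2223IP…` certified the σ three-band (d–p_x–p_y + t_pp, t_pp′) Fermi-surface `t′/t` window of this box at its own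
hole count and compared it with the box's object-E row (router/BOXES/Tl2Ba2Ca2Cu3O10.md l.38 «tp/t (E) @Cu-IP [−0.447, −0.346]»). `EmeryAxialFermiSurfaceShape` +
`EmeryAxialConductionBand` (TRANSFER THEOREM `condBand_le_iff`, no separation hypothesis) prove that the four-orbital model of [AndersenEtAl1995] /
[PavariniEtAl2001] — Cu-4s (and through it the apical orbitals) added to the σ model — has, AT ITS FERMI LEVEL, exactly the conduction-band occupied
set, filling and Fermi surface of the σ model with CO-SHIFTED O–O hoppings `(t_pp + a, t_pp′ + a)`, ONE scalar `a = a_F = t_sp²/(ε_s − ε_F) ≥ 0`.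
So «how much axial channel does the one-band FS of record require beyond the box's σ rows?» is a one-parameter question, answered here slab by slab
(sub-box rule version B, `EmeryFermiFillingSubBoxB`; edges 0, 0.02, 0.05, 0.1, 0.2, 0.25, 0.3, 0.35, 0.4, 0.5 eV; Δ_pd × t_pd split 2 × 2):

| slab | a (eV) | ε_F window (eV above ε_d) | certified t′/t window | vs E row [-0.447, -0.346] |
|---|---|---|---|---|
| 0 | [0, 0.02] | [1.18, 2.3] | [-0.3458, -0.2564] | SHORT |
| 1 | [0.02, 0.05] | [1.16, 2.3] | [-0.3592, -0.2659] | MEETS |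
| 2 | [0.05, 0.1] | [1.14, 2.28] | [-0.3799, -0.2798] | MEETS |
| 3 | [0.1, 0.2] | [1.08, 2.28] | [-0.4184, -0.3] | MEETS |
| 4 | [0.2, 0.25] | [1.08, 2.22] | [-0.4319, -0.3314] | MEETS |
| 5 | [0.25, 0.3] | [1.08, 2.18] | [-0.4464, -0.3448] | MEETS |
| 6 | [0.3, 0.35] | [1.06, 2.16] | [-0.4595, -0.3573] | MEETS |
| 7 | [0.35, 0.4] | [1.04, 2.16] | [-0.4715, -0.3684] | MEETS |
| 8 | [0.4, 0.5] | [1.02, 2.16] | [-0.4955, -0.3779] | MEETS |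

READING (certified, numbers not adjectives): `a ∈ [0, 0.02]` ⇒ the co-shifted Fermi surface is STILL LESS cuprate-like than the E row (`t′/t > -0.346`): the REQUIRED axial admixture at the Fermi level is `a_F > 0.02` eV (`emeryBoxTl2223IPK11Src_axial_short`). The four-orbital form of the exclusion(s) is `emeryBoxTl2223IPK11Src_fourOrbital_short`:
for ANY axial level `ε_s` and coupling `t_sp`, a four-orbital completion of a box point whose conduction band holds the box's electrons at a Fermi level `ε_F < ε_s`
with `t_sp²/(ε_s − ε_F)` in the excluded range does NOT reproduce the E row. (Pavarini's range parameter for the PURE four-orbital model is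
`r = ½/(1 + s)`, `s = (ε_s − ε_F)(ε_F − ε_p)/(2t_sp)² = (ε_F + Δ_pd)/(4·a_total)`, where `a_total` would be the WHOLE O–O co-shift; the box's `t_pp, t_pp′` rows
already contain part of the axial channel when they come from a three-band Wannier fit, so `a_F` here is the ADDITIONAL admixture — a model-form
distance, not a material constant.)

WHAT THIS IS NOT: not a statement that the material's parameters ARE in the box (SCREENING-GRADE provenance); `U = 0` band kinematics; no phase
sentence; the E row is a [float] literature refit. Sources: [AndersenEtAl1995, §§5–6]; [PavariniEtAl2001, Eqs. (1)–(3), Fig. 3];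
[HybertsenSchluterChristensen1989, Eq. (1)].
-/

noncomputable section

namespace Summit.Ventures.CertifiedManyBodySolver.Downfold.Emery

open Real Set
open Summit.Ventures.CertifiedManyBodySolver.Downfold

/-! ## §1 Slab windows (raw co-shifted coordinates `t_pp′ := t_pp + a`, `c′ := t_pp′ + a`) -/

/-- **Slab 0, a ∈ [0, 0.02] eV**: on the co-shifted box (t_pp + a ∈ [0.62, 0.75], t_pp′ + a ∈ [0.15, 0.21]) at per-spin
filling ∈ [0.41, 0.43]: `ε_F ∈ [1.18, 2.3]` and `t′/t ∈ [-0.3458, -0.2564]` — SHORT vs the E row. [folklore] -/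
theorem tl2223IPAxSlab0_window {Δ tpd tpp c ε : ℝ} (hΔ : Δ ∈ Set.Icc (37 / 25 : ℝ) (56 / 25 : ℝ))
    (ha : tpd ∈ Set.Icc (59 / 50 : ℝ) (139 / 100 : ℝ)) (hb : tpp ∈ Set.Icc (31 / 50 : ℝ) (3 / 4 : ℝ))
    (hc : c ∈ Set.Icc (3 / 20 : ℝ) (21 / 100 : ℝ))
    (hν : abFilling Δ tpd tpp c ε ∈ Set.Icc (41 / 100 : ℝ) (43 / 100 : ℝ)) :
    ε ∈ Set.Icc (59 / 50 : ℝ) (23 / 10 : ℝ) ∧ fsRatio Δ tpd tpp c ε ∈ Set.Icc (-(1729 / 5000 : ℝ)) (-(641 / 2500 : ℝ)) := by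
  have hΔ' := hΔ
  constructor
  · clear hΔ
    rcases mem_Icc_split hΔ' (93 / 50 : ℝ) with hΔ' | hΔ'
    · rcases mem_Icc_split ha (257 / 200 : ℝ) with ha' | ha'
      · have h := (tl2223IPAx0Sub_0_0 hΔ' ha' hb hc hν).1
        exact ⟨le_trans (by norm_num) h.1, h.2.trans (by norm_num)⟩
      · have h := (tl2223IPAx0Sub_0_1 hΔ' ha' hb hc hν).1
        exact ⟨le_trans (by norm_num) h.1, h.2.trans (by norm_num)⟩
    · rcases mem_Icc_split ha (257 / 200 : ℝ) with ha' | ha'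
      · have h := (tl2223IPAx0Sub_1_0 hΔ' ha' hb hc hν).1
        exact ⟨le_trans (by norm_num) h.1, h.2.trans (by norm_num)⟩
      · have h := (tl2223IPAx0Sub_1_1 hΔ' ha' hb hc hν).1
        exact ⟨le_trans (by norm_num) h.1, h.2.trans (by norm_num)⟩
  · clear hΔ
    rcases mem_Icc_split hΔ' (93 / 50 : ℝ) with hΔ' | hΔ'
    · rcases mem_Icc_split ha (257 / 200 : ℝ) with ha' | ha'
      · have h := (tl2223IPAx0Sub_0_0 hΔ' ha' hb hc hν).2
        exact ⟨le_trans (by norm_num) h.1, h.2.trans (by norm_num)⟩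
      · have h := (tl2223IPAx0Sub_0_1 hΔ' ha' hb hc hν).2
        exact ⟨le_trans (by norm_num) h.1, h.2.trans (by norm_num)⟩
    · rcases mem_Icc_split ha (257 / 200 : ℝ) with ha' | ha'
      · have h := (tl2223IPAx0Sub_1_0 hΔ' ha' hb hc hν).2
        exact ⟨le_trans (by norm_num) h.1, h.2.trans (by norm_num)⟩
      · have h := (tl2223IPAx0Sub_1_1 hΔ' ha' hb hc hν).2
        exact ⟨le_trans (by norm_num) h.1, h.2.trans (by norm_num)⟩

/-- **Slab 1, a ∈ [0.02, 0.05] eV**: on the co-shifted box (t_pp + a ∈ [0.64, 0.78], t_pp′ + a ∈ [0.17, 0.24]) at per-spin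
filling ∈ [0.41, 0.43]: `ε_F ∈ [1.16, 2.3]` and `t′/t ∈ [-0.3592, -0.2659]` — MEETS vs the E row. [folklore] -/
theorem tl2223IPAxSlab1_window {Δ tpd tpp c ε : ℝ} (hΔ : Δ ∈ Set.Icc (37 / 25 : ℝ) (56 / 25 : ℝ))
    (ha : tpd ∈ Set.Icc (59 / 50 : ℝ) (139 / 100 : ℝ)) (hb : tpp ∈ Set.Icc (16 / 25 : ℝ) (39 / 50 : ℝ))
    (hc : c ∈ Set.Icc (17 / 100 : ℝ) (6 / 25 : ℝ))
    (hν : abFilling Δ tpd tpp c ε ∈ Set.Icc (41 / 100 : ℝ) (43 / 100 : ℝ)) :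
    ε ∈ Set.Icc (29 / 25 : ℝ) (23 / 10 : ℝ) ∧ fsRatio Δ tpd tpp c ε ∈ Set.Icc (-(449 / 1250 : ℝ)) (-(2659 / 10000 : ℝ)) := by
  have hΔ' := hΔ
  constructor
  · clear hΔ
    rcases mem_Icc_split hΔ' (93 / 50 : ℝ) with hΔ' | hΔ'
    · rcases mem_Icc_split ha (257 / 200 : ℝ) with ha' | ha'
      · have h := (tl2223IPAx1Sub_0_0 hΔ' ha' hb hc hν).1
        exact ⟨le_trans (by norm_num) h.1, h.2.trans (by norm_num)⟩
      · have h := (tl2223IPAx1Sub_0_1 hΔ' ha' hb hc hν).1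
        exact ⟨le_trans (by norm_num) h.1, h.2.trans (by norm_num)⟩
    · rcases mem_Icc_split ha (257 / 200 : ℝ) with ha' | ha'
      · have h := (tl2223IPAx1Sub_1_0 hΔ' ha' hb hc hν).1
        exact ⟨le_trans (by norm_num) h.1, h.2.trans (by norm_num)⟩
      · have h := (tl2223IPAx1Sub_1_1 hΔ' ha' hb hc hν).1
        exact ⟨le_trans (by norm_num) h.1, h.2.trans (by norm_num)⟩
  · clear hΔ
    rcases mem_Icc_split hΔ' (93 / 50 : ℝ) with hΔ' | hΔ'
    · rcases mem_Icc_split ha (257 / 200 : ℝ) with ha' | ha'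
      · have h := (tl2223IPAx1Sub_0_0 hΔ' ha' hb hc hν).2
        exact ⟨le_trans (by norm_num) h.1, h.2.trans (by norm_num)⟩
      · have h := (tl2223IPAx1Sub_0_1 hΔ' ha' hb hc hν).2
        exact ⟨le_trans (by norm_num) h.1, h.2.trans (by norm_num)⟩
    · rcases mem_Icc_split ha (257 / 200 : ℝ) with ha' | ha'
      · have h := (tl2223IPAx1Sub_1_0 hΔ' ha' hb hc hν).2
        exact ⟨le_trans (by norm_num) h.1, h.2.trans (by norm_num)⟩
      · have h := (tl2223IPAx1Sub_1_1 hΔ' ha' hb hc hν).2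
        exact ⟨le_trans (by norm_num) h.1, h.2.trans (by norm_num)⟩

/-- **Slab 2, a ∈ [0.05, 0.1] eV**: on the co-shifted box (t_pp + a ∈ [0.67, 0.83], t_pp′ + a ∈ [0.2, 0.29]) at per-spin
filling ∈ [0.41, 0.43]: `ε_F ∈ [1.14, 2.28]` and `t′/t ∈ [-0.3799, -0.2798]` — MEETS vs the E row. [folklore] -/
theorem tl2223IPAxSlab2_window {Δ tpd tpp c ε : ℝ} (hΔ : Δ ∈ Set.Icc (37 / 25 : ℝ) (56 / 25 : ℝ))
    (ha : tpd ∈ Set.Icc (59 / 50 : ℝ) (139 / 100 : ℝ)) (hb : tpp ∈ Set.Icc (67 / 100 : ℝ) (83 / 100 : ℝ))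
    (hc : c ∈ Set.Icc (1 / 5 : ℝ) (29 / 100 : ℝ))
    (hν : abFilling Δ tpd tpp c ε ∈ Set.Icc (41 / 100 : ℝ) (43 / 100 : ℝ)) :
    ε ∈ Set.Icc (57 / 50 : ℝ) (57 / 25 : ℝ) ∧ fsRatio Δ tpd tpp c ε ∈ Set.Icc (-(3799 / 10000 : ℝ)) (-(1399 / 5000 : ℝ)) := by
  have hΔ' := hΔ
  constructor
  · clear hΔ
    rcases mem_Icc_split hΔ' (93 / 50 : ℝ) with hΔ' | hΔ'
    · rcases mem_Icc_split ha (257 / 200 : ℝ) with ha' | ha'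
      · have h := (tl2223IPAx2Sub_0_0 hΔ' ha' hb hc hν).1
        exact ⟨le_trans (by norm_num) h.1, h.2.trans (by norm_num)⟩
      · have h := (tl2223IPAx2Sub_0_1 hΔ' ha' hb hc hν).1
        exact ⟨le_trans (by norm_num) h.1, h.2.trans (by norm_num)⟩
    · rcases mem_Icc_split ha (257 / 200 : ℝ) with ha' | ha'
      · have h := (tl2223IPAx2Sub_1_0 hΔ' ha' hb hc hν).1
        exact ⟨le_trans (by norm_num) h.1, h.2.trans (by norm_num)⟩
      · have h := (tl2223IPAx2Sub_1_1 hΔ' ha' hb hc hν).1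
        exact ⟨le_trans (by norm_num) h.1, h.2.trans (by norm_num)⟩
  · clear hΔ
    rcases mem_Icc_split hΔ' (93 / 50 : ℝ) with hΔ' | hΔ'
    · rcases mem_Icc_split ha (257 / 200 : ℝ) with ha' | ha'
      · have h := (tl2223IPAx2Sub_0_0 hΔ' ha' hb hc hν).2
        exact ⟨le_trans (by norm_num) h.1, h.2.trans (by norm_num)⟩
      · have h := (tl2223IPAx2Sub_0_1 hΔ' ha' hb hc hν).2
        exact ⟨le_trans (by norm_num) h.1, h.2.trans (by norm_num)⟩
    · rcases mem_Icc_split ha (257 / 200 : ℝ) with ha' | ha'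
      · have h := (tl2223IPAx2Sub_1_0 hΔ' ha' hb hc hν).2
        exact ⟨le_trans (by norm_num) h.1, h.2.trans (by norm_num)⟩
      · have h := (tl2223IPAx2Sub_1_1 hΔ' ha' hb hc hν).2
        exact ⟨le_trans (by norm_num) h.1, h.2.trans (by norm_num)⟩

/-- **Slab 3, a ∈ [0.1, 0.2] eV**: on the co-shifted box (t_pp + a ∈ [0.72, 0.93], t_pp′ + a ∈ [0.25, 0.39]) at per-spin
filling ∈ [0.41, 0.43]: `ε_F ∈ [1.08, 2.28]` and `t′/t ∈ [-0.4184, -0.3]` — MEETS vs the E row. [folklore] -/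
theorem tl2223IPAxSlab3_window {Δ tpd tpp c ε : ℝ} (hΔ : Δ ∈ Set.Icc (37 / 25 : ℝ) (56 / 25 : ℝ))
    (ha : tpd ∈ Set.Icc (59 / 50 : ℝ) (139 / 100 : ℝ)) (hb : tpp ∈ Set.Icc (18 / 25 : ℝ) (93 / 100 : ℝ))
    (hc : c ∈ Set.Icc (1 / 4 : ℝ) (39 / 100 : ℝ))
    (hν : abFilling Δ tpd tpp c ε ∈ Set.Icc (41 / 100 : ℝ) (43 / 100 : ℝ)) :
    ε ∈ Set.Icc (27 / 25 : ℝ) (57 / 25 : ℝ) ∧ fsRatio Δ tpd tpp c ε ∈ Set.Icc (-(523 / 1250 : ℝ)) (-(3 / 10 : ℝ)) := by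
  have hΔ' := hΔ
  constructor
  · clear hΔ
    rcases mem_Icc_split hΔ' (93 / 50 : ℝ) with hΔ' | hΔ'
    · rcases mem_Icc_split ha (257 / 200 : ℝ) with ha' | ha'
      · have h := (tl2223IPAx3Sub_0_0 hΔ' ha' hb hc hν).1
        exact ⟨le_trans (by norm_num) h.1, h.2.trans (by norm_num)⟩
      · have h := (tl2223IPAx3Sub_0_1 hΔ' ha' hb hc hν).1
        exact ⟨le_trans (by norm_num) h.1, h.2.trans (by norm_num)⟩
    · rcases mem_Icc_split ha (257 / 200 : ℝ) with ha' | ha'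
      · have h := (tl2223IPAx3Sub_1_0 hΔ' ha' hb hc hν).1
        exact ⟨le_trans (by norm_num) h.1, h.2.trans (by norm_num)⟩
      · have h := (tl2223IPAx3Sub_1_1 hΔ' ha' hb hc hν).1
        exact ⟨le_trans (by norm_num) h.1, h.2.trans (by norm_num)⟩
  · clear hΔ
    rcases mem_Icc_split hΔ' (93 / 50 : ℝ) with hΔ' | hΔ'
    · rcases mem_Icc_split ha (257 / 200 : ℝ) with ha' | ha'
      · have h := (tl2223IPAx3Sub_0_0 hΔ' ha' hb hc hν).2
        exact ⟨le_trans (by norm_num) h.1, h.2.trans (by norm_num)⟩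
      · have h := (tl2223IPAx3Sub_0_1 hΔ' ha' hb hc hν).2
        exact ⟨le_trans (by norm_num) h.1, h.2.trans (by norm_num)⟩
    · rcases mem_Icc_split ha (257 / 200 : ℝ) with ha' | ha'
      · have h := (tl2223IPAx3Sub_1_0 hΔ' ha' hb hc hν).2
        exact ⟨le_trans (by norm_num) h.1, h.2.trans (by norm_num)⟩
      · have h := (tl2223IPAx3Sub_1_1 hΔ' ha' hb hc hν).2
        exact ⟨le_trans (by norm_num) h.1, h.2.trans (by norm_num)⟩

/-- **Slab 4, a ∈ [0.2, 0.25] eV**: on the co-shifted box (t_pp + a ∈ [0.82, 0.98], t_pp′ + a ∈ [0.35, 0.44]) at per-spin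
filling ∈ [0.41, 0.43]: `ε_F ∈ [1.08, 2.22]` and `t′/t ∈ [-0.4319, -0.3314]` — MEETS vs the E row. [folklore] -/
theorem tl2223IPAxSlab4_window {Δ tpd tpp c ε : ℝ} (hΔ : Δ ∈ Set.Icc (37 / 25 : ℝ) (56 / 25 : ℝ))
    (ha : tpd ∈ Set.Icc (59 / 50 : ℝ) (139 / 100 : ℝ)) (hb : tpp ∈ Set.Icc (41 / 50 : ℝ) (49 / 50 : ℝ))
    (hc : c ∈ Set.Icc (7 / 20 : ℝ) (11 / 25 : ℝ))
    (hν : abFilling Δ tpd tpp c ε ∈ Set.Icc (41 / 100 : ℝ) (43 / 100 : ℝ)) :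
    ε ∈ Set.Icc (27 / 25 : ℝ) (111 / 50 : ℝ) ∧ fsRatio Δ tpd tpp c ε ∈ Set.Icc (-(4319 / 10000 : ℝ)) (-(1657 / 5000 : ℝ)) := by
  have hΔ' := hΔ
  constructor
  · clear hΔ
    rcases mem_Icc_split hΔ' (93 / 50 : ℝ) with hΔ' | hΔ'
    · rcases mem_Icc_split ha (257 / 200 : ℝ) with ha' | ha'
      · have h := (tl2223IPAx4Sub_0_0 hΔ' ha' hb hc hν).1
        exact ⟨le_trans (by norm_num) h.1, h.2.trans (by norm_num)⟩
      · have h := (tl2223IPAx4Sub_0_1 hΔ' ha' hb hc hν).1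
        exact ⟨le_trans (by norm_num) h.1, h.2.trans (by norm_num)⟩
    · rcases mem_Icc_split ha (257 / 200 : ℝ) with ha' | ha'
      · have h := (tl2223IPAx4Sub_1_0 hΔ' ha' hb hc hν).1
        exact ⟨le_trans (by norm_num) h.1, h.2.trans (by norm_num)⟩
      · have h := (tl2223IPAx4Sub_1_1 hΔ' ha' hb hc hν).1
        exact ⟨le_trans (by norm_num) h.1, h.2.trans (by norm_num)⟩
  · clear hΔ
    rcases mem_Icc_split hΔ' (93 / 50 : ℝ) with hΔ' | hΔ'
    · rcases mem_Icc_split ha (257 / 200 : ℝ) with ha' | ha'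
      · have h := (tl2223IPAx4Sub_0_0 hΔ' ha' hb hc hν).2
        exact ⟨le_trans (by norm_num) h.1, h.2.trans (by norm_num)⟩
      · have h := (tl2223IPAx4Sub_0_1 hΔ' ha' hb hc hν).2
        exact ⟨le_trans (by norm_num) h.1, h.2.trans (by norm_num)⟩
    · rcases mem_Icc_split ha (257 / 200 : ℝ) with ha' | ha'
      · have h := (tl2223IPAx4Sub_1_0 hΔ' ha' hb hc hν).2
        exact ⟨le_trans (by norm_num) h.1, h.2.trans (by norm_num)⟩
      · have h := (tl2223IPAx4Sub_1_1 hΔ' ha' hb hc hν).2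
        exact ⟨le_trans (by norm_num) h.1, h.2.trans (by norm_num)⟩

/-- **Slab 5, a ∈ [0.25, 0.3] eV**: on the co-shifted box (t_pp + a ∈ [0.87, 1.03], t_pp′ + a ∈ [0.4, 0.49]) at per-spin
filling ∈ [0.41, 0.43]: `ε_F ∈ [1.08, 2.18]` and `t′/t ∈ [-0.4464, -0.3448]` — MEETS vs the E row. [folklore] -/
theorem tl2223IPAxSlab5_window {Δ tpd tpp c ε : ℝ} (hΔ : Δ ∈ Set.Icc (37 / 25 : ℝ) (56 / 25 : ℝ))
    (ha : tpd ∈ Set.Icc (59 / 50 : ℝ) (139 / 100 : ℝ)) (hb : tpp ∈ Set.Icc (87 / 100 : ℝ) (103 / 100 : ℝ))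
    (hc : c ∈ Set.Icc (2 / 5 : ℝ) (49 / 100 : ℝ))
    (hν : abFilling Δ tpd tpp c ε ∈ Set.Icc (41 / 100 : ℝ) (43 / 100 : ℝ)) :
    ε ∈ Set.Icc (27 / 25 : ℝ) (109 / 50 : ℝ) ∧ fsRatio Δ tpd tpp c ε ∈ Set.Icc (-(279 / 625 : ℝ)) (-(431 / 1250 : ℝ)) := by
  have hΔ' := hΔ
  constructor
  · clear hΔ
    rcases mem_Icc_split hΔ' (93 / 50 : ℝ) with hΔ' | hΔ'
    · rcases mem_Icc_split ha (257 / 200 : ℝ) with ha' | ha'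
      · have h := (tl2223IPAx5Sub_0_0 hΔ' ha' hb hc hν).1
        exact ⟨le_trans (by norm_num) h.1, h.2.trans (by norm_num)⟩
      · have h := (tl2223IPAx5Sub_0_1 hΔ' ha' hb hc hν).1
        exact ⟨le_trans (by norm_num) h.1, h.2.trans (by norm_num)⟩
    · rcases mem_Icc_split ha (257 / 200 : ℝ) with ha' | ha'
      · have h := (tl2223IPAx5Sub_1_0 hΔ' ha' hb hc hν).1
        exact ⟨le_trans (by norm_num) h.1, h.2.trans (by norm_num)⟩
      · have h := (tl2223IPAx5Sub_1_1 hΔ' ha' hb hc hν).1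
        exact ⟨le_trans (by norm_num) h.1, h.2.trans (by norm_num)⟩
  · clear hΔ
    rcases mem_Icc_split hΔ' (93 / 50 : ℝ) with hΔ' | hΔ'
    · rcases mem_Icc_split ha (257 / 200 : ℝ) with ha' | ha'
      · have h := (tl2223IPAx5Sub_0_0 hΔ' ha' hb hc hν).2
        exact ⟨le_trans (by norm_num) h.1, h.2.trans (by norm_num)⟩
      · have h := (tl2223IPAx5Sub_0_1 hΔ' ha' hb hc hν).2
        exact ⟨le_trans (by norm_num) h.1, h.2.trans (by norm_num)⟩
    · rcases mem_Icc_split ha (257 / 200 : ℝ) with ha' | ha'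
      · have h := (tl2223IPAx5Sub_1_0 hΔ' ha' hb hc hν).2
        exact ⟨le_trans (by norm_num) h.1, h.2.trans (by norm_num)⟩
      · have h := (tl2223IPAx5Sub_1_1 hΔ' ha' hb hc hν).2
        exact ⟨le_trans (by norm_num) h.1, h.2.trans (by norm_num)⟩

/-- **Slab 6, a ∈ [0.3, 0.35] eV**: on the co-shifted box (t_pp + a ∈ [0.92, 1.08], t_pp′ + a ∈ [0.45, 0.54]) at per-spin
filling ∈ [0.41, 0.43]: `ε_F ∈ [1.06, 2.16]` and `t′/t ∈ [-0.4595, -0.3573]` — MEETS vs the E row. [folklore] -/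
theorem tl2223IPAxSlab6_window {Δ tpd tpp c ε : ℝ} (hΔ : Δ ∈ Set.Icc (37 / 25 : ℝ) (56 / 25 : ℝ))
    (ha : tpd ∈ Set.Icc (59 / 50 : ℝ) (139 / 100 : ℝ)) (hb : tpp ∈ Set.Icc (23 / 25 : ℝ) (27 / 25 : ℝ))
    (hc : c ∈ Set.Icc (9 / 20 : ℝ) (27 / 50 : ℝ))
    (hν : abFilling Δ tpd tpp c ε ∈ Set.Icc (41 / 100 : ℝ) (43 / 100 : ℝ)) :
    ε ∈ Set.Icc (53 / 50 : ℝ) (54 / 25 : ℝ) ∧ fsRatio Δ tpd tpp c ε ∈ Set.Icc (-(919 / 2000 : ℝ)) (-(3573 / 10000 : ℝ)) := by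
  have hΔ' := hΔ
  constructor
  · clear hΔ
    rcases mem_Icc_split hΔ' (93 / 50 : ℝ) with hΔ' | hΔ'
    · rcases mem_Icc_split ha (257 / 200 : ℝ) with ha' | ha'
      · have h := (tl2223IPAx6Sub_0_0 hΔ' ha' hb hc hν).1
        exact ⟨le_trans (by norm_num) h.1, h.2.trans (by norm_num)⟩
      · have h := (tl2223IPAx6Sub_0_1 hΔ' ha' hb hc hν).1
        exact ⟨le_trans (by norm_num) h.1, h.2.trans (by norm_num)⟩
    · rcases mem_Icc_split ha (257 / 200 : ℝ) with ha' | ha'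
      · have h := (tl2223IPAx6Sub_1_0 hΔ' ha' hb hc hν).1
        exact ⟨le_trans (by norm_num) h.1, h.2.trans (by norm_num)⟩
      · have h := (tl2223IPAx6Sub_1_1 hΔ' ha' hb hc hν).1
        exact ⟨le_trans (by norm_num) h.1, h.2.trans (by norm_num)⟩
  · clear hΔ
    rcases mem_Icc_split hΔ' (93 / 50 : ℝ) with hΔ' | hΔ'
    · rcases mem_Icc_split ha (257 / 200 : ℝ) with ha' | ha'
      · have h := (tl2223IPAx6Sub_0_0 hΔ' ha' hb hc hν).2
        exact ⟨le_trans (by norm_num) h.1, h.2.trans (by norm_num)⟩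
      · have h := (tl2223IPAx6Sub_0_1 hΔ' ha' hb hc hν).2
        exact ⟨le_trans (by norm_num) h.1, h.2.trans (by norm_num)⟩
    · rcases mem_Icc_split ha (257 / 200 : ℝ) with ha' | ha'
      · have h := (tl2223IPAx6Sub_1_0 hΔ' ha' hb hc hν).2
        exact ⟨le_trans (by norm_num) h.1, h.2.trans (by norm_num)⟩
      · have h := (tl2223IPAx6Sub_1_1 hΔ' ha' hb hc hν).2
        exact ⟨le_trans (by norm_num) h.1, h.2.trans (by norm_num)⟩

/-- **Slab 7, a ∈ [0.35, 0.4] eV**: on the co-shifted box (t_pp + a ∈ [0.97, 1.13], t_pp′ + a ∈ [0.5, 0.59]) at per-spin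
filling ∈ [0.41, 0.43]: `ε_F ∈ [1.04, 2.16]` and `t′/t ∈ [-0.4715, -0.3684]` — MEETS vs the E row. [folklore] -/
theorem tl2223IPAxSlab7_window {Δ tpd tpp c ε : ℝ} (hΔ : Δ ∈ Set.Icc (37 / 25 : ℝ) (56 / 25 : ℝ))
    (ha : tpd ∈ Set.Icc (59 / 50 : ℝ) (139 / 100 : ℝ)) (hb : tpp ∈ Set.Icc (97 / 100 : ℝ) (113 / 100 : ℝ))
    (hc : c ∈ Set.Icc (1 / 2 : ℝ) (59 / 100 : ℝ))
    (hν : abFilling Δ tpd tpp c ε ∈ Set.Icc (41 / 100 : ℝ) (43 / 100 : ℝ)) :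
    ε ∈ Set.Icc (26 / 25 : ℝ) (54 / 25 : ℝ) ∧ fsRatio Δ tpd tpp c ε ∈ Set.Icc (-(943 / 2000 : ℝ)) (-(921 / 2500 : ℝ)) := by
  have hΔ' := hΔ
  constructor
  · clear hΔ
    rcases mem_Icc_split hΔ' (93 / 50 : ℝ) with hΔ' | hΔ'
    · rcases mem_Icc_split ha (257 / 200 : ℝ) with ha' | ha'
      · have h := (tl2223IPAx7Sub_0_0 hΔ' ha' hb hc hν).1
        exact ⟨le_trans (by norm_num) h.1, h.2.trans (by norm_num)⟩
      · have h := (tl2223IPAx7Sub_0_1 hΔ' ha' hb hc hν).1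
        exact ⟨le_trans (by norm_num) h.1, h.2.trans (by norm_num)⟩
    · rcases mem_Icc_split ha (257 / 200 : ℝ) with ha' | ha'
      · have h := (tl2223IPAx7Sub_1_0 hΔ' ha' hb hc hν).1
        exact ⟨le_trans (by norm_num) h.1, h.2.trans (by norm_num)⟩
      · have h := (tl2223IPAx7Sub_1_1 hΔ' ha' hb hc hν).1
        exact ⟨le_trans (by norm_num) h.1, h.2.trans (by norm_num)⟩
  · clear hΔ
    rcases mem_Icc_split hΔ' (93 / 50 : ℝ) with hΔ' | hΔ'
    · rcases mem_Icc_split ha (257 / 200 : ℝ) with ha' | ha'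
      · have h := (tl2223IPAx7Sub_0_0 hΔ' ha' hb hc hν).2
        exact ⟨le_trans (by norm_num) h.1, h.2.trans (by norm_num)⟩
      · have h := (tl2223IPAx7Sub_0_1 hΔ' ha' hb hc hν).2
        exact ⟨le_trans (by norm_num) h.1, h.2.trans (by norm_num)⟩
    · rcases mem_Icc_split ha (257 / 200 : ℝ) with ha' | ha'
      · have h := (tl2223IPAx7Sub_1_0 hΔ' ha' hb hc hν).2
        exact ⟨le_trans (by norm_num) h.1, h.2.trans (by norm_num)⟩
      · have h := (tl2223IPAx7Sub_1_1 hΔ' ha' hb hc hν).2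
        exact ⟨le_trans (by norm_num) h.1, h.2.trans (by norm_num)⟩

/-- **Slab 8, a ∈ [0.4, 0.5] eV**: on the co-shifted box (t_pp + a ∈ [1.02, 1.23], t_pp′ + a ∈ [0.55, 0.69]) at per-spin
filling ∈ [0.41, 0.43]: `ε_F ∈ [1.02, 2.16]` and `t′/t ∈ [-0.4955, -0.3779]` — MEETS vs the E row. [folklore] -/
theorem tl2223IPAxSlab8_window {Δ tpd tpp c ε : ℝ} (hΔ : Δ ∈ Set.Icc (37 / 25 : ℝ) (56 / 25 : ℝ))
    (ha : tpd ∈ Set.Icc (59 / 50 : ℝ) (139 / 100 : ℝ)) (hb : tpp ∈ Set.Icc (51 / 50 : ℝ) (123 / 100 : ℝ))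
    (hc : c ∈ Set.Icc (11 / 20 : ℝ) (69 / 100 : ℝ))
    (hν : abFilling Δ tpd tpp c ε ∈ Set.Icc (41 / 100 : ℝ) (43 / 100 : ℝ)) :
    ε ∈ Set.Icc (51 / 50 : ℝ) (54 / 25 : ℝ) ∧ fsRatio Δ tpd tpp c ε ∈ Set.Icc (-(991 / 2000 : ℝ)) (-(3779 / 10000 : ℝ)) := by
  have hΔ' := hΔ
  constructor
  · clear hΔ
    rcases mem_Icc_split hΔ' (93 / 50 : ℝ) with hΔ' | hΔ'
    · rcases mem_Icc_split ha (257 / 200 : ℝ) with ha' | ha'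
      · have h := (tl2223IPAx8Sub_0_0 hΔ' ha' hb hc hν).1
        exact ⟨le_trans (by norm_num) h.1, h.2.trans (by norm_num)⟩
      · have h := (tl2223IPAx8Sub_0_1 hΔ' ha' hb hc hν).1
        exact ⟨le_trans (by norm_num) h.1, h.2.trans (by norm_num)⟩
    · rcases mem_Icc_split ha (257 / 200 : ℝ) with ha' | ha'
      · have h := (tl2223IPAx8Sub_1_0 hΔ' ha' hb hc hν).1
        exact ⟨le_trans (by norm_num) h.1, h.2.trans (by norm_num)⟩
      · have h := (tl2223IPAx8Sub_1_1 hΔ' ha' hb hc hν).1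
        exact ⟨le_trans (by norm_num) h.1, h.2.trans (by norm_num)⟩
  · clear hΔ
    rcases mem_Icc_split hΔ' (93 / 50 : ℝ) with hΔ' | hΔ'
    · rcases mem_Icc_split ha (257 / 200 : ℝ) with ha' | ha'
      · have h := (tl2223IPAx8Sub_0_0 hΔ' ha' hb hc hν).2
        exact ⟨le_trans (by norm_num) h.1, h.2.trans (by norm_num)⟩
      · have h := (tl2223IPAx8Sub_0_1 hΔ' ha' hb hc hν).2
        exact ⟨le_trans (by norm_num) h.1, h.2.trans (by norm_num)⟩
    · rcases mem_Icc_split ha (257 / 200 : ℝ) with ha' | ha'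
      · have h := (tl2223IPAx8Sub_1_0 hΔ' ha' hb hc hν).2
        exact ⟨le_trans (by norm_num) h.1, h.2.trans (by norm_num)⟩
      · have h := (tl2223IPAx8Sub_1_1 hΔ' ha' hb hc hν).2
        exact ⟨le_trans (by norm_num) h.1, h.2.trans (by norm_num)⟩

end Summit.Ventures.CertifiedManyBodySolver.Downfold.Emery
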